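import Summits.CriticalPhenomena.PercolationContinuityZ3.Theorems.PercNearOneGluingNoHeavyLowerTailSahiHubCornerBoxSquare
import Mathlib.Tactic.Linarith
import Mathlib.Tactic.Positivity
import Mathlib.Tactic.Ring
import HarnessLib

/-!
# `NoHeavyLowerTail` (crux stmt-CriticalPhenomena-4575), P2 — THE EXTENDED SQUARE IDENTITY FOR THE BOX FORM: own coefficient
# `ρ ∈ [0,2]` (up to the whole own term) and a DECOUPLED antipodal cross coefficient `σ ≤ 1`

Seat `prim-masterthm-p2`, gen 32 (memo `FROM-prim-masterthm-p2-g32-BOX-FLOWS-AND-STAR.md` §6, SAHI-ROUTE.md §4.59;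
`--supports stmt-CriticalPhenomena-4575`).  No `sorry`, no named facts, standard axioms.

`…SahiHubCornerBoxSquare` decomposes the antipodal box sum as `boxSum a D = 2·(Σ_b wB·boxFib ρ + boxCP ρ + boxEnv ρ)` for a ratio
`ρ` whose value at a slot serves BOTH as the "own" coefficient there and as the cross coefficient at the antipodal slot; its criterion
needs `ρ ∈ [0,1]`.  That family is NOT complete: the memo (§6) exhibits an explicit cell with two co-shared coins (hub required by `h`,
`g` constant on its private block) where `boxSum = 2Ȳ_⊤ − 1.45·H̄₁ ≥ 0.45·H̄₁` but EVERY `ρ ∈ [0,1]^8` has `boxEnv ρ < 0` in both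
orientations — positivity requires harvesting MORE than one copy of the own slice term `2·E_b[g_s Y_s]` into the environment.
THIS FILE gives the two-parameter decomposition that does so:
* `kerPair₂ ρ σ x y b = g_{1x}[(2−ρ_{1x})Ys_{1x} − F_{0y}H₁ − (1−σ_{1x})Ys_{0y}] + g_{0x}[(2−ρ_{0x})Ys_{0x} − F_{1y}H₀ − (1−σ_{0x})Ys_{1y}]`
  (own coefficient `ρ_s`, cross coefficient `σ_s` of the SAME slot; the old kernel is `σ_{(z,x)} = ρ_{(1−z,y)}`), `cpPair₂`, `envPair₂`,
  and their box sums `boxFib₂`, `boxCP₂`, `boxEnv₂`.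
* `pairKer_eq_slot₂` and **`boxSum_eq_square₂`**: `boxSum a D = 2·(Σ_b wB·boxFib₂ ρ σ a D b + boxCP₂ ρ σ a D + boxEnv₂ ρ σ a D)` for ALL `ρ, σ`.
* `boxCP₂_nonneg` for `ρ ≥ 0` and `σ ≤ 1` (NO upper bound on `ρ`, no lower bound on `σ`), and **`boxSum_nonneg_of_fibre₂`**: if such
  `(ρ, σ)` make the fibre kernel nonnegative at every fibre and `boxEnv₂ ≥ 0`, then `boxSum a D ≥ 0`.
Numerically (memo §6, kit j250962) this extended family — equivalently `ρ ∈ [0,2]`, `σ ≤ 1` — certifies every sampled cell.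
HONEST LABEL: identity + criterion; the box inequalities, T₁ with ≥ 2 co-shared coins and Kahn's `C₃` OPEN. [this work]
-/

noncomputable section

open scoped Classical

namespace Summit.CriticalPhenomena.PercolationContinuityZ3.Theorems

namespace SahiHubCornerChain

open Finset Literature.Combinatorics.Sahi2008 SahiHubCorner SahiHubTwoLevel

section Defs

variable {κ α β : Type} [Fintype α] [Fintype β]
  (wA : α → ℝ) (wB : β → ℝ) (f : Fin 2 → Finset κ → α → ℝ) (g : Fin 2 → Finset κ → β → ℝ) (h : Fin 2 → α → β → ℝ)
  (ρ σ : Fin 2 → Finset κ → ℝ)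

/-- Two-parameter fibre kernel of the two slots over `x` (antipodal partner `y`): own coefficient `ρ_s`, cross coefficient `σ_s`. [this work] -/
def kerPair₂ (x y : Finset κ) (b : β) : ℝ :=
  g 1 x b * ((2 - ρ 1 x) * Ys wA f h 1 x b - Fp wA f 0 y * Hsl wA h 1 b - (1 - σ 1 x) * Ys wA f h 0 y b)
  + g 0 x b * ((2 - ρ 0 x) * Ys wA f h 0 x b - Fp wA f 1 y * Hsl wA h 0 b - (1 - σ 0 x) * Ys wA f h 1 y b)

/-- Two-parameter slice-covariance part:
`ρ_{1x}Cov_b(g_{1x},Ys_{1x}) + (1−σ_{1x})Cov_b(g_{1x},Ys_{0y}) + ρ_{0x}Cov_b(g_{0x},Ys_{0x}) + (1−σ_{0x})Cov_b(g_{0x},Ys_{1y})`. [this work] -/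
def cpPair₂ (x y : Finset κ) : ℝ :=
  ρ 1 x * (Mq wA wB f g h 1 x 1 x - Gp wB g 1 x * Yp wA wB f h 1 x)
  + (1 - σ 1 x) * (Mq wA wB f g h 1 x 0 y - Gp wB g 1 x * Yp wA wB f h 0 y)
  + ρ 0 x * (Mq wA wB f g h 0 x 0 x - Gp wB g 0 x * Yp wA wB f h 0 x)
  + (1 - σ 0 x) * (Mq wA wB f g h 0 x 1 y - Gp wB g 0 x * Yp wA wB f h 1 y)

/-- Two-parameter environment part of the two slots over `x`. [this work] -/
def envPair₂ (x y : Finset κ) : ℝ :=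
  ρ 1 x * Gp wB g 1 x * Yp wA wB f h 1 x + ρ 0 x * Gp wB g 0 x * Yp wA wB f h 0 x
  - σ 1 x * Gp wB g 1 x * Yp wA wB f h 0 y - σ 0 x * Gp wB g 0 x * Yp wA wB f h 1 y
  - Hb wA wB h 0 * Fp wA f 1 x * Gp wB g 1 x - Hb wA wB h 1 * Fp wA f 0 x * Gp wB g 0 x
  - Fp wA f 1 y * Gp wB g 1 x * Hb wA wB h 1 + Fp wA f 0 y * Gp wB g 1 x * Hb wA wB h 1
  + Fp wA f 1 y * Gp wB g 0 x * Hb wA wB h 1 + Fp wA f 1 y * Gp wB g 1 x * Hb wA wB h 0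

variable (a D : Finset κ)

/-- Two-parameter fibre kernel of the box at the fibre `b`. [this work] -/
def boxFib₂ (b : β) : ℝ := ∑ u ∈ D.powerset, kerPair₂ wA f g h ρ σ (a ∪ u) (a ∪ (D \ u)) b
/-- Two-parameter slice-covariance part of the box. [this work] -/
def boxCP₂ : ℝ := ∑ u ∈ D.powerset, cpPair₂ wA wB f g h ρ σ (a ∪ u) (a ∪ (D \ u))
/-- **Two-parameter environment remainder of the box.** [this work] -/
def boxEnv₂ : ℝ := ∑ u ∈ D.powerset, envPair₂ wA wB f g h ρ σ (a ∪ u) (a ∪ (D \ u))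

end Defs

section Identity

variable {κ α β : Type} [Fintype α] [Fintype β]
  {wA : α → ℝ} {wB : β → ℝ} {f : Fin 2 → Finset κ → α → ℝ} {g : Fin 2 → Finset κ → β → ℝ} {h : Fin 2 → α → β → ℝ}
  {ρ σ : Fin 2 → Finset κ → ℝ}

/-- `Σ_b wB(b)·kerPair₂` in the mixed moments. [this work] -/
theorem sum_kerPair₂ (x y : Finset κ) :
    (∑ b, wB b * kerPair₂ wA f g h ρ σ x y b) =
      (2 - ρ 1 x) * Mq wA wB f g h 1 x 1 x - Fp wA f 0 y * Kp wA wB g h 1 x - (1 - σ 1 x) * Mq wA wB f g h 1 x 0 y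
      + ((2 - ρ 0 x) * Mq wA wB f g h 0 x 0 x - Fp wA f 1 y * Kp wA wB g h 0 x - (1 - σ 0 x) * Mq wA wB f g h 0 x 1 y) := by
  have e : ∀ b, wB b * kerPair₂ wA f g h ρ σ x y b =
      (2 - ρ 1 x) * (wB b * (g 1 x b * Ys wA f h 1 x b)) - Fp wA f 0 y * (wB b * (g 1 x b * Hsl wA h 1 b))
        - (1 - σ 1 x) * (wB b * (g 1 x b * Ys wA f h 0 y b))
      + ((2 - ρ 0 x) * (wB b * (g 0 x b * Ys wA f h 0 x b)) - Fp wA f 1 y * (wB b * (g 0 x b * Hsl wA h 0 b))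
        - (1 - σ 0 x) * (wB b * (g 0 x b * Ys wA f h 1 y b))) := fun b => by
    unfold kerPair₂; ring
  simp only [e, sum_add_distrib, sum_sub_distrib, ← mul_sum]
  rfl

/-- **THE TWO-PARAMETER SLOT IDENTITY**: `pairKer x y = Σ_b wB·kerPair₂ ρ σ x y + cpPair₂ ρ σ x y + envPair₂ ρ σ x y` (any `ρ, σ`). [this work] -/
theorem pairKer_eq_slot₂ (x y : Finset κ) :
    pairKer wA wB f g h x y =
      (∑ b, wB b * kerPair₂ wA f g h ρ σ x y b) + cpPair₂ wA wB f g h ρ σ x y + envPair₂ wA wB f g h ρ σ x y := by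
  rw [sum_kerPair₂]
  have hJ : ∀ z c, Jp wA wB f g h z c = Mq wA wB f g h z c z c := fun z c => rfl
  unfold pairKer cpPair₂ envPair₂
  rw [hJ, hJ]
  ring

/-- **THE TWO-PARAMETER SQUARE IDENTITY** (every dimension, every `ρ, σ`):
`boxSum a D = 2·(Σ_b wB(b)·boxFib₂ ρ σ a D b + boxCP₂ ρ σ a D + boxEnv₂ ρ σ a D)`. [this work] -/
theorem boxSum_eq_square₂ (ρ σ : Fin 2 → Finset κ → ℝ) (a D : Finset κ) :
    boxSum wA wB f g h a D =
      2 * ((∑ b, wB b * boxFib₂ wA f g h ρ σ a D b) + boxCP₂ wA wB f g h ρ σ a D + boxEnv₂ wA wB f g h ρ σ a D) := by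
  rw [boxSum_eq_two_mul_sum_pairKer]
  congr 1
  unfold boxFib₂ boxCP₂ boxEnv₂
  rw [sum_congr rfl fun u _ => pairKer_eq_slot₂ (ρ := ρ) (σ := σ) (a ∪ u) (a ∪ (D \ u)), sum_add_distrib, sum_add_distrib]
  congr 2
  simp only [mul_sum]
  rw [sum_comm]

end Identity

section Positivity

variable {κ α β : Type} [Fintype α] [Fintype β]
  {wA : α → ℝ} {wB : β → ℝ} {f : Fin 2 → Finset κ → α → ℝ} {g : Fin 2 → Finset κ → β → ℝ} {h : Fin 2 → α → β → ℝ}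

/-- **`boxCP₂ ≥ 0` for `ρ ≥ 0` and `σ ≤ 1`** (no upper bound on `ρ`, no lower bound on `σ`). [this work] -/
theorem boxCP₂_nonneg [DistribLattice β] (hB : IsFKGMeasure wB) (hA0 : ∀ a, 0 ≤ wA a)
    (hf0 : ∀ z c a, 0 ≤ f z c a) (hg0 : ∀ z c b, 0 ≤ g z c b) (hgb : ∀ z c, Monotone (g z c))
    (hh0 : ∀ z a b, 0 ≤ h z a b) (hhb : ∀ z a, Monotone (h z a))
    {ρ σ : Fin 2 → Finset κ → ℝ} (hρ0 : ∀ z c, 0 ≤ ρ z c) (hσ1 : ∀ z c, σ z c ≤ 1) (a D : Finset κ) :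
    0 ≤ boxCP₂ wA wB f g h ρ σ a D := by
  unfold boxCP₂
  refine sum_nonneg fun u _ => ?_
  have c := Mq_sub_nonneg hB hA0 hf0 hg0 hgb hh0 hhb
  unfold cpPair₂
  have t1 := mul_nonneg (hρ0 1 (a ∪ u)) (c 1 (a ∪ u) 1 (a ∪ u))
  have t2 := mul_nonneg (sub_nonneg.2 (hσ1 1 (a ∪ u))) (c 1 (a ∪ u) 0 (a ∪ (D \ u)))
  have t3 := mul_nonneg (hρ0 0 (a ∪ u)) (c 0 (a ∪ u) 0 (a ∪ u))
  have t4 := mul_nonneg (sub_nonneg.2 (hσ1 0 (a ∪ u))) (c 0 (a ∪ u) 1 (a ∪ (D \ u)))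
  linarith

/-- **THE TWO-PARAMETER CRITERION (any dimension).**  If `ρ ≥ 0` and `σ ≤ 1` on the slots make the fibre kernel `boxFib₂` nonnegative
at every fibre and the environment remainder `boxEnv₂` nonnegative, then `boxSum a D ≥ 0`.  (Fibre positivity forces `ρ ≤ 2` in
practice; `ρ > 1` is genuinely needed in some cells, memo §6.) [this work] -/
theorem boxSum_nonneg_of_fibre₂ [DistribLattice β] (hB : IsFKGMeasure wB) (hA0 : ∀ a, 0 ≤ wA a)
    (hf0 : ∀ z c a, 0 ≤ f z c a) (hg0 : ∀ z c b, 0 ≤ g z c b) (hgb : ∀ z c, Monotone (g z c))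
    (hh0 : ∀ z a b, 0 ≤ h z a b) (hhb : ∀ z a, Monotone (h z a))
    {ρ σ : Fin 2 → Finset κ → ℝ} (hρ0 : ∀ z c, 0 ≤ ρ z c) (hσ1 : ∀ z c, σ z c ≤ 1) (a D : Finset κ)
    (hfib : ∀ b, 0 ≤ boxFib₂ wA f g h ρ σ a D b) (henv : 0 ≤ boxEnv₂ wA wB f g h ρ σ a D) :
    0 ≤ boxSum wA wB f g h a D := by
  rw [boxSum_eq_square₂ ρ σ a D]
  have h1 : 0 ≤ ∑ b, wB b * boxFib₂ wA f g h ρ σ a D b := sum_nonneg fun b _ => mul_nonneg (hB.nonneg b) (hfib b)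
  have h2 := boxCP₂_nonneg hB hA0 hf0 hg0 hgb hh0 hhb hρ0 hσ1 a D
  linarith

omit [Fintype β] in
/-- The one-parameter kernel of `…BoxSquare` is the case `σ_{(z,x)} = ρ_{(1−z, y)}` (cross coefficient = own coefficient of the antipode). [this work] -/
theorem kerPair₂_coupled (ρ : Fin 2 → Finset κ → ℝ) (x y : Finset κ) (b : β) :
    kerPair₂ wA f g h ρ (fun z c => ρ (1 - z) (if c = x then y else c)) x y b = kerPair wA f g h ρ x y b := by
  unfold kerPair₂ kerPair
  simp

end Positivity

end SahiHubCornerChain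

end Summit.CriticalPhenomena.PercolationContinuityZ3.Theorems
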